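import Summits.CriticalPhenomena.PercolationContinuityZ3.Theorems.PercNearOneGluingNoHeavyQuantLongTailQuintHubAlgK2
import Summits.CriticalPhenomena.PercolationContinuityZ3.Theorems.PercNearOneGluingNoHeavyQuantLongTailQuadHubRoute
import HarnessLib

/-!
# QUANT lane R8, T-DEC: THE LONG-TAIL QUINT HUB, ROUTE FILE — the routes of the low atoms `5lo`, `5lo+K` of the width-5 hub
# `S(γ₁) ∗ ⋯ ∗ S(γ₅)` of shape `{lo, lo+K; γ}`, `2lo < K ≤ 4lo`, at ONE outer gate (census-1 gen 35)

builds on p205010 (kernel theorem, internal audit signed; external expert review pending)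

Support file (`--supports stmt-CriticalPhenomena-4575`), QUANT lane seat prim-quant-census-1 (gen 35); memo
`run/shared/lean/prim/quant/prim-quant-census-1/g35/QUADHUB-G35.md` §5.  Theorems only, standard axioms, no sorries.  VERBATIM width-5 twin of
`…QuantLongTailQuadHubRoute`: the width-5 instance of the uniform rule `t(s) = min(⌊D/K⌋+2, j−1) − s` (memo §1; rule search `g35/code/exp3_width_rule.py`,
503 832 instances, 0 exceptions).  `ν` the gated law with masses `a·u₀..a·u₅` at `5lo + sK`, `T = a(5lo + KΣγᵢ)`, `y = ax`, `D = T − 10lo`; the only lows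
are `5lo` (`D > 0`) and `5lo+K` (`D > 2K`) since `K ≤ 4lo`.
* `exists_least_of_five` — symmetry reduction to the least gate.
* `quintHub_routeOne` — ONE low (`0 < D ≤ 2K`): `5lo → 5lo+2K` when `D < K` (`quintHub_capAx`, `quintHub_capBK`), `→ 5lo+3K` when `K ≤ D ≤ 2K`
  (`quintHub_capCK`, `quintHub_capDK`); compatible and COST-SAFE (from `5y(lo+K) ≤ T` and `K ≤ 4lo`).
* `quintHub_routeTwo` — TWO lows (`D > 2K`): `5lo → 5lo+4K` (`quintHub_capGK`, `quintHub_capHK`; cost-safe, the target may be far when `2K > 5lo`) and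
  `5lo+K → 5lo+3K` (`quintHub_capEK`, `quintHub_capFK`; target below `T`).
The SDEC theorem is `…QuantLongTailQuintHub`.

HONEST STATUS.  Route bookkeeping; `SiblingStep`, `GluedDominatedMass`, `SDECConvClosed`, `FarTreeRow` OPEN; RATE class (log\*) / honest sentence of
`run/shared/lean/prim/quant/README.md` unchanged.  [this work].  Nothing here is cited as a published result.  The gluing rows served
[cite: KozmaNitzan2024, Conjecture 3 (p. 15)]; product measure [cite: Grimmett1999, §1.3 p. 10].
-/

noncomputable section
open scoped BigOperators

namespace Summit.CriticalPhenomena.PercolationContinuityZ3.Theorems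
namespace Quant
namespace LawDec

/-! ### A symmetry reduction -/

/-- the least of five reals, as a case split keeping the other four in their original order. [this work] -/
theorem exists_least_of_five (γ₁ γ₂ γ₃ γ₄ γ₅ : ℝ) :
    ∃ p q r s t : ℝ, ((p = γ₁ ∧ q = γ₂ ∧ r = γ₃ ∧ s = γ₄ ∧ t = γ₅) ∨ (p = γ₂ ∧ q = γ₁ ∧ r = γ₃ ∧ s = γ₄ ∧ t = γ₅) ∨
      (p = γ₃ ∧ q = γ₁ ∧ r = γ₂ ∧ s = γ₄ ∧ t = γ₅) ∨ (p = γ₄ ∧ q = γ₁ ∧ r = γ₂ ∧ s = γ₃ ∧ t = γ₅) ∨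
      (p = γ₅ ∧ q = γ₁ ∧ r = γ₂ ∧ s = γ₃ ∧ t = γ₄)) ∧ p ≤ q ∧ p ≤ r ∧ p ≤ s ∧ p ≤ t := by
  obtain ⟨p, q, r, s, hperm, hpq, hpr, hps⟩ := exists_least_of_four γ₁ γ₂ γ₃ γ₄
  by_cases h5 : p ≤ γ₅
  · rcases hperm with ⟨rfl, rfl, rfl, rfl⟩ | ⟨rfl, rfl, rfl, rfl⟩ | ⟨rfl, rfl, rfl, rfl⟩ | ⟨rfl, rfl, rfl, rfl⟩
    · exact ⟨_, _, _, _, _, Or.inl ⟨rfl, rfl, rfl, rfl, rfl⟩, hpq, hpr, hps, h5⟩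
    · exact ⟨_, _, _, _, _, Or.inr (Or.inl ⟨rfl, rfl, rfl, rfl, rfl⟩), hpq, hpr, hps, h5⟩
    · exact ⟨_, _, _, _, _, Or.inr (Or.inr (Or.inl ⟨rfl, rfl, rfl, rfl, rfl⟩)), hpq, hpr, hps, h5⟩
    · exact ⟨_, _, _, _, _, Or.inr (Or.inr (Or.inr (Or.inl ⟨rfl, rfl, rfl, rfl, rfl⟩))), hpq, hpr, hps, h5⟩
  · push Not at h5
    have h51 : γ₅ ≤ γ₁ := by rcases hperm with ⟨rfl, rfl, rfl, rfl⟩ | ⟨rfl, rfl, rfl, rfl⟩ | ⟨rfl, rfl, rfl, rfl⟩ | ⟨rfl, rfl, rfl, rfl⟩ <;> linarith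
    have h52 : γ₅ ≤ γ₂ := by rcases hperm with ⟨rfl, rfl, rfl, rfl⟩ | ⟨rfl, rfl, rfl, rfl⟩ | ⟨rfl, rfl, rfl, rfl⟩ | ⟨rfl, rfl, rfl, rfl⟩ <;> linarith
    have h53 : γ₅ ≤ γ₃ := by rcases hperm with ⟨rfl, rfl, rfl, rfl⟩ | ⟨rfl, rfl, rfl, rfl⟩ | ⟨rfl, rfl, rfl, rfl⟩ | ⟨rfl, rfl, rfl, rfl⟩ <;> linarith
    have h54 : γ₅ ≤ γ₄ := by rcases hperm with ⟨rfl, rfl, rfl, rfl⟩ | ⟨rfl, rfl, rfl, rfl⟩ | ⟨rfl, rfl, rfl, rfl⟩ | ⟨rfl, rfl, rfl, rfl⟩ <;> linarith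
    exact ⟨_, _, _, _, _, Or.inr (Or.inr (Or.inr (Or.inr ⟨rfl, rfl, rfl, rfl, rfl⟩))), h51, h52, h53, h54⟩

/-! ### The routes of the long-tail quint hub at one outer gate -/

set_option maxHeartbeats 1600000 in
/-- **the route of the quint hub at one outer gate, ONE low** (`ν` the gated law with masses `a·u₀..a·u₅` at `5lo + sK`, `y = ax` the gated floor,
`T = a(5lo + KΣgᵢ)` the gated mean with `10lo < T ≤ 10lo+2K`, `g₁` the least gate, `2lo < K ≤ 4lo`): the low atom `5lo` ships ENTIRELY to `5lo+2K` when
`T < 10lo+K` and to `5lo+3K` otherwise; the target is compatible, has the capacity at the layer-free rate, and is cost-safe (`y(t − 5lo) ≤ T − 5lo`). [this work] -/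
theorem quintHub_routeOne (lo K : ℕ) (hloK : lo < K) (hK2 : 2 * lo < K) (hK8 : K ≤ 4 * lo) (ν : ℕ → ℝ) (y T a g₁ g₂ g₃ g₄ g₅ x : ℝ)
    (g0 : ∀ h, 0 ≤ ν h) (h12 : g₁ ≤ g₂) (h13 : g₁ ≤ g₃) (h14 : g₁ ≤ g₄) (h15 : g₁ ≤ g₅) (hg : (lo : ℝ) ≤ K * g₁) (h21 : g₂ < 1) (h31 : g₃ < 1) (h41 : g₄ < 1) (h51 : g₅ < 1)
    (hx0 : 0 < x) (hxg : x * ((lo : ℝ) + K) ≤ lo + K * g₁) (ha0 : 0 < a) (ha1 : a ≤ 1) (hy : y = a * x)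
    (hT : T = a * (5 * (lo : ℝ) + K * (g₁ + g₂ + g₃ + g₄ + g₅))) (hT10 : 10 * (lo : ℝ) < T) (hT102 : T ≤ 10 * (lo : ℝ) + 2 * K)
    (v0 : ν (5 * lo) = a * ((1 - g₁) * (1 - g₂) * (1 - g₃) * (1 - g₄) * (1 - g₅)))
    (v2 : ν (5 * lo + 2 * K) = a * (g₁ * g₂ * (1 - g₃) * (1 - g₄) * (1 - g₅) + g₁ * g₃ * (1 - g₂) * (1 - g₄) * (1 - g₅) + g₁ * g₄ * (1 - g₂) * (1 - g₃) * (1 - g₅)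
          + g₁ * g₅ * (1 - g₂) * (1 - g₃) * (1 - g₄) + g₂ * g₃ * (1 - g₁) * (1 - g₄) * (1 - g₅) + g₂ * g₄ * (1 - g₁) * (1 - g₃) * (1 - g₅)
          + g₂ * g₅ * (1 - g₁) * (1 - g₃) * (1 - g₄) + g₃ * g₄ * (1 - g₁) * (1 - g₂) * (1 - g₅) + g₃ * g₅ * (1 - g₁) * (1 - g₂) * (1 - g₄)
          + g₄ * g₅ * (1 - g₁) * (1 - g₂) * (1 - g₃)))
    (v3 : ν (5 * lo + 3 * K) = a * (g₁ * g₂ * g₃ * (1 - g₄) * (1 - g₅) + g₁ * g₂ * g₄ * (1 - g₃) * (1 - g₅) + g₁ * g₂ * g₅ * (1 - g₃) * (1 - g₄)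
          + g₁ * g₃ * g₄ * (1 - g₂) * (1 - g₅) + g₁ * g₃ * g₅ * (1 - g₂) * (1 - g₄) + g₁ * g₄ * g₅ * (1 - g₂) * (1 - g₃)
          + g₂ * g₃ * g₄ * (1 - g₁) * (1 - g₅) + g₂ * g₃ * g₅ * (1 - g₁) * (1 - g₄) + g₂ * g₄ * g₅ * (1 - g₁) * (1 - g₃)
          + g₃ * g₄ * g₅ * (1 - g₁) * (1 - g₂))) :
    ∃ t : ℕ, (t = 5 * lo + 2 * K ∨ t = 5 * lo + 3 * K) ∧ (T < ((5 * lo : ℕ) : ℝ) + (t : ℝ)) ∧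
      freeRate y T (5 * lo) t * ν (5 * lo) ≤ ν t ∧ y * ((t : ℝ) - ((5 * lo : ℕ) : ℝ)) ≤ T - ((5 * lo : ℕ) : ℝ) := by
  have hlo1 : 1 ≤ lo := by omega
  have hlo0 : (0 : ℝ) < lo := by exact_mod_cast (show 0 < lo by omega)
  have hK2R : 2 * (lo : ℝ) ≤ K := by exact_mod_cast hK2.le
  have hK4R : (K : ℝ) ≤ 4 * lo := by exact_mod_cast hK8
  have hK0 : (0 : ℝ) < K := by linarith
  have hg10 : 0 < g₁ := by
    by_contra hc; push Not at hc
    have : (K : ℝ) * g₁ ≤ 0 := mul_nonpos_of_nonneg_of_nonpos hK0.le hc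
    linarith
  have hg11 : g₁ < 1 := lt_of_le_of_lt h12 h21
  have hg₂K : (lo : ℝ) ≤ K * g₂ := le_trans hg (mul_le_mul_of_nonneg_left h12 hK0.le)
  have hg₃K : (lo : ℝ) ≤ K * g₃ := le_trans hg (mul_le_mul_of_nonneg_left h13 hK0.le)
  have hg₄K : (lo : ℝ) ≤ K * g₄ := le_trans hg (mul_le_mul_of_nonneg_left h14 hK0.le)
  have hg₅K : (lo : ℝ) ≤ K * g₅ := le_trans hg (mul_le_mul_of_nonneg_left h15 hK0.le)
  obtain ⟨hu0n, hu1n, hu2n, hu3n, hu4n⟩ := quintHub_masses_nonneg g₁ g₂ g₃ g₄ g₅ hg10.le (by linarith) (by linarith) (by linarith) (by linarith)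
    hg11.le h21.le h31.le h41.le h51.le
  set u0 : ℝ := ((1 - g₁) * (1 - g₂) * (1 - g₃) * (1 - g₄) * (1 - g₅)) with hu0
  set u1 : ℝ := (g₁ * (1 - g₂) * (1 - g₃) * (1 - g₄) * (1 - g₅) + g₂ * (1 - g₁) * (1 - g₃) * (1 - g₄) * (1 - g₅)
          + g₃ * (1 - g₁) * (1 - g₂) * (1 - g₄) * (1 - g₅) + g₄ * (1 - g₁) * (1 - g₂) * (1 - g₃) * (1 - g₅)
          + g₅ * (1 - g₁) * (1 - g₂) * (1 - g₃) * (1 - g₄)) with hu1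
  set u2 : ℝ := (g₁ * g₂ * (1 - g₃) * (1 - g₄) * (1 - g₅) + g₁ * g₃ * (1 - g₂) * (1 - g₄) * (1 - g₅) + g₁ * g₄ * (1 - g₂) * (1 - g₃) * (1 - g₅)
          + g₁ * g₅ * (1 - g₂) * (1 - g₃) * (1 - g₄) + g₂ * g₃ * (1 - g₁) * (1 - g₄) * (1 - g₅) + g₂ * g₄ * (1 - g₁) * (1 - g₃) * (1 - g₅)
          + g₂ * g₅ * (1 - g₁) * (1 - g₃) * (1 - g₄) + g₃ * g₄ * (1 - g₁) * (1 - g₂) * (1 - g₅) + g₃ * g₅ * (1 - g₁) * (1 - g₂) * (1 - g₄)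
          + g₄ * g₅ * (1 - g₁) * (1 - g₂) * (1 - g₃)) with hu2
  set u3 : ℝ := (g₁ * g₂ * g₃ * (1 - g₄) * (1 - g₅) + g₁ * g₂ * g₄ * (1 - g₃) * (1 - g₅) + g₁ * g₂ * g₅ * (1 - g₃) * (1 - g₄)
          + g₁ * g₃ * g₄ * (1 - g₂) * (1 - g₅) + g₁ * g₃ * g₅ * (1 - g₂) * (1 - g₄) + g₁ * g₄ * g₅ * (1 - g₂) * (1 - g₃)
          + g₂ * g₃ * g₄ * (1 - g₁) * (1 - g₅) + g₂ * g₃ * g₅ * (1 - g₁) * (1 - g₄) + g₂ * g₄ * g₅ * (1 - g₁) * (1 - g₃)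
          + g₃ * g₄ * g₅ * (1 - g₁) * (1 - g₂)) with hu3
  set u4 : ℝ := (g₁ * g₂ * g₃ * g₄ * (1 - g₅) + g₁ * g₂ * g₃ * g₅ * (1 - g₄) + g₁ * g₂ * g₄ * g₅ * (1 - g₃) + g₁ * g₃ * g₄ * g₅ * (1 - g₂)
          + g₂ * g₃ * g₄ * g₅ * (1 - g₁)) with hu4
  set T₀ : ℝ := 5 * (lo : ℝ) + K * (g₁ + g₂ + g₃ + g₄ + g₅) with hT₀
  have hT0p : 0 < T₀ := by
    have := mul_pos hK0 (by linarith : 0 < g₁ + g₂ + g₃ + g₄ + g₅); rw [hT₀]; linarith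
  have hTle : T ≤ T₀ := by
    have := mul_le_mul_of_nonneg_right ha1 hT0p.le; rw [hT]; linarith
  have hT0top : T₀ < 5 * (lo : ℝ) + 5 * K := by
    have := mul_lt_mul_of_pos_left (by linarith : g₁ + g₂ + g₃ + g₄ + g₅ < 5) hK0; rw [hT₀]; linarith
  have hx1 : x < 1 := by
    have : (lo : ℝ) + K * g₁ < lo + K := by have := mul_lt_mul_of_pos_left hg11 hK0; linarith
    by_contra hc; push Not at hc
    have : 1 * ((lo : ℝ) + K) ≤ x * (lo + K) := mul_le_mul_of_nonneg_right hc (by linarith)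
    linarith
  have hyx : y ≤ x := by rw [hy]; have := mul_le_mul_of_nonneg_right ha1 hx0.le; linarith
  have hy0 : 0 < y := by rw [hy]; exact mul_pos ha0 hx0
  have hy1 : y < 1 := lt_of_le_of_lt hyx hx1
  -- the crude floor bound `5y(lo+K) ≤ T`
  have hy5 : 5 * y * ((lo : ℝ) + K) ≤ T := by
    have h1 : 5 * (x * ((lo : ℝ) + K)) ≤ T₀ := by
      have : (K : ℝ) * (5 * g₁) ≤ K * (g₁ + g₂ + g₃ + g₄ + g₅) := mul_le_mul_of_nonneg_left (by linarith) hK0.le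
      rw [hT₀]; linarith
    have h2 := mul_le_mul_of_nonneg_left h1 ha0.le
    rw [hy, hT]; linarith
  -- floor capacity of `5lo → 5lo+2K`
  have hxA : x * (u0 + u2) ≤ u2 := by
    have h := quintHub_capAx (lo : ℝ) K g₁ g₂ g₃ g₄ g₅ x hlo0 hK2R hK4R hg h12 h13 h14 h15 h21.le h31.le h41.le h51.le hxg
    rw [← hu0, ← hu2] at h; exact h
  clear_value u0 u1 u2 u3 u4 T₀
  set D : ℝ := T - 10 * (lo : ℝ) with hD
  have hDp : 0 < D := by rw [hD]; linarith
  have hDle : D ≤ K * (g₁ + g₂ + g₃ + g₄ + g₅) - 5 * lo := by have h := hTle; rw [hT₀] at h; rw [hD]; linarith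
  have hD2K : D ≤ 2 * K := by rw [hD]; linarith
  have c5lo : ((5 * lo : ℕ) : ℝ) = 5 * (lo : ℝ) := by push_cast; ring
  by_cases hDK : D < K
  · -- FIRST branch: all of `5lo` to `5lo + 2K`, rate `max(y, D/(2K))`
    refine ⟨5 * lo + 2 * K, Or.inl rfl, by push_cast; linarith, ?_, ?_⟩
    · have ed : (((5 * lo + 2 * K : ℕ) : ℝ) - ((5 * lo : ℕ) : ℝ)) = 2 * K := by push_cast; ring
      have eD : T - 2 * (((5 * lo : ℕ) : ℝ)) = D := by rw [c5lo, hD]; ring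
      have eθ : freeRate y T (5 * lo) (5 * lo + 2 * K) = max y (D / (2 * K)) / (1 - max y (D / (2 * K))) := by
        unfold freeRate; rw [ed, eD]
      have hK20 : (0 : ℝ) < 2 * K := by linarith
      have hρ1 : D / (2 * K) < 1 := by rw [div_lt_one hK20]; linarith
      have hθlt : max y (D / (2 * K)) < 1 := max_lt hy1 hρ1
      rw [eθ]
      refine rate_mul_le_of_theta hθlt ?_ (g0 _)
      rw [v0, v2, show a * u0 + a * u2 = a * (u0 + u2) by ring, max_mul_of_nonneg _ _ (mul_nonneg ha0.le (add_nonneg hu0n hu2n))]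
      refine max_le ?_ ?_
      · have h1 : y * (u0 + u2) ≤ x * (u0 + u2) := mul_le_mul_of_nonneg_right hyx (add_nonneg hu0n hu2n)
        have h2 : a * (y * (u0 + u2)) ≤ a * u2 := mul_le_mul_of_nonneg_left (le_trans h1 hxA) ha0.le
        linarith
      · have hB := quintHub_capBK (lo : ℝ) K g₁ g₂ g₃ g₄ g₅ D hlo0 hK2R hK4R hg hg₂K hg₃K hg₄K hg₅K hg11.le h21.le h31.le h41.le h51.le hDK.le hDle
        rw [← hu0, ← hu2] at hB
        rw [div_mul_eq_mul_div, div_le_iff₀ hK20]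
        have h3 : a * (D * (u0 + u2)) ≤ a * (2 * K * u2) := mul_le_mul_of_nonneg_left (by linarith) ha0.le
        linarith
    · -- cost-safe: `2yK ≤ 2y(lo+K) ≤ (2/5)T ≤ T − 5lo`
      push_cast
      have : 0 ≤ y * (lo : ℝ) := mul_nonneg hy0.le hlo0.le
      linarith
  · -- SECOND branch: all of `5lo` to `5lo + 3K`, rate `max(y, D/(3K))`
    push Not at hDK
    refine ⟨5 * lo + 3 * K, Or.inr rfl, by push_cast; linarith, ?_, ?_⟩
    · have ed : (((5 * lo + 3 * K : ℕ) : ℝ) - ((5 * lo : ℕ) : ℝ)) = 3 * K := by push_cast; ring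
      have eD : T - 2 * (((5 * lo : ℕ) : ℝ)) = D := by rw [c5lo, hD]; ring
      have eθ : freeRate y T (5 * lo) (5 * lo + 3 * K) = max y (D / (3 * K)) / (1 - max y (D / (3 * K))) := by
        unfold freeRate; rw [ed, eD]
      have hK30 : (0 : ℝ) < 3 * K := by linarith
      have hρ1 : D / (3 * K) < 1 := by rw [div_lt_one hK30]; linarith
      have hθlt : max y (D / (3 * K)) < 1 := max_lt hy1 hρ1
      rw [eθ]
      refine rate_mul_le_of_theta hθlt ?_ (g0 _)
      rw [v0, v3, show a * u0 + a * u3 = a * (u0 + u3) by ring, max_mul_of_nonneg _ _ (mul_nonneg ha0.le (add_nonneg hu0n hu3n))]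
      refine max_le ?_ ?_
      · have hC := quintHub_capCK (lo : ℝ) K g₁ g₂ g₃ g₄ g₅ D hlo0 hK2R hK4R hg hg₂K hg₃K hg₄K hg₅K hg11.le h21.le h31.le h41.le h51.le hDK hD2K hDle
        rw [← hu0, ← hu3] at hC
        have hB0 : (0 : ℝ) < 5 * ((lo : ℝ) + K) := by linarith
        have h1 : 5 * ((lo : ℝ) + K) * (y * (u0 + u3)) ≤ (D + 10 * lo) * (u0 + u3) := by
          have := mul_le_mul_of_nonneg_right hy5 (add_nonneg hu0n hu3n); rw [hD]; linarith
        have h3 := le_of_mul_le_mul_left (h1.trans hC) hB0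
        have h4 : a * (y * (u0 + u3)) ≤ a * u3 := mul_le_mul_of_nonneg_left h3 ha0.le
        linarith
      · have hDc := quintHub_capDK (lo : ℝ) K g₁ g₂ g₃ g₄ g₅ D hlo0 hK2R hK4R hg hg₂K hg₃K hg₄K hg₅K hg11.le h21.le h31.le h41.le h51.le hDK hD2K hDle
        rw [← hu0, ← hu3] at hDc
        rw [div_mul_eq_mul_div, div_le_iff₀ hK30]
        have h3 : a * (D * (u0 + u3)) ≤ a * (3 * K * u3) := mul_le_mul_of_nonneg_left (by linarith) ha0.le
        linarith
    · -- cost-safe: `3yK·5(lo+K) ≤ 3KT ≤ 5(lo+K)(T − 5lo)` since `T ≥ 10lo+K`, `K ≤ 4lo`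
      push_cast
      have hB0 : (0 : ℝ) < 5 * ((lo : ℝ) + K) := by linarith
      have hT10K : 10 * (lo : ℝ) + K ≤ T := by rw [hD] at hDK; linarith
      have h1 : 5 * ((lo : ℝ) + K) * (y * (3 * K)) ≤ 3 * K * T := by
        have := mul_le_mul_of_nonneg_right hy5 (show (0 : ℝ) ≤ 3 * K by linarith); linarith
      have h2 : 3 * (K : ℝ) * T ≤ 5 * ((lo : ℝ) + K) * (T - 5 * lo) := by
        nlinarith [mul_nonneg (sub_nonneg.2 hK4R) hlo0.le, mul_nonneg (sub_nonneg.2 hT10K) hlo0.le,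
          mul_nonneg (sub_nonneg.2 hT10K) hK0.le]
      have h3 : 5 * ((lo : ℝ) + K) * (y * (3 * K)) ≤ 5 * ((lo : ℝ) + K) * (T - 5 * lo) := le_trans h1 h2
      have h4 := le_of_mul_le_mul_left h3 hB0
      linarith

set_option maxHeartbeats 1600000 in
/-- **the routes of the quint hub at one outer gate, TWO lows** (`10lo + 2K < T`: the atoms `5lo` and `5lo+K` are both below `T/2`): `5lo` ships to
`5lo+4K` (compatible, capacity, COST-SAFE — this target may exceed `T` when `2K > 5lo`) and `5lo+K` to `5lo+3K` (below `T`). [this work] -/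
theorem quintHub_routeTwo (lo K : ℕ) (hloK : lo < K) (hK2 : 2 * lo < K) (hK8 : K ≤ 4 * lo) (ν : ℕ → ℝ) (y T a g₁ g₂ g₃ g₄ g₅ x : ℝ)
    (g0 : ∀ h, 0 ≤ ν h) (h12 : g₁ ≤ g₂) (h13 : g₁ ≤ g₃) (h14 : g₁ ≤ g₄) (h15 : g₁ ≤ g₅) (hg : (lo : ℝ) ≤ K * g₁) (h21 : g₂ < 1) (h31 : g₃ < 1) (h41 : g₄ < 1) (h51 : g₅ < 1)
    (hx0 : 0 < x) (hxg : x * ((lo : ℝ) + K) ≤ lo + K * g₁) (ha0 : 0 < a) (ha1 : a ≤ 1) (hy : y = a * x)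
    (hT : T = a * (5 * (lo : ℝ) + K * (g₁ + g₂ + g₃ + g₄ + g₅))) (hT102 : 10 * (lo : ℝ) + 2 * K < T)
    (v0 : ν (5 * lo) = a * ((1 - g₁) * (1 - g₂) * (1 - g₃) * (1 - g₄) * (1 - g₅)))
    (v1 : ν (5 * lo + K) = a * (g₁ * (1 - g₂) * (1 - g₃) * (1 - g₄) * (1 - g₅) + g₂ * (1 - g₁) * (1 - g₃) * (1 - g₄) * (1 - g₅)
          + g₃ * (1 - g₁) * (1 - g₂) * (1 - g₄) * (1 - g₅) + g₄ * (1 - g₁) * (1 - g₂) * (1 - g₃) * (1 - g₅)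
          + g₅ * (1 - g₁) * (1 - g₂) * (1 - g₃) * (1 - g₄)))
    (v3 : ν (5 * lo + 3 * K) = a * (g₁ * g₂ * g₃ * (1 - g₄) * (1 - g₅) + g₁ * g₂ * g₄ * (1 - g₃) * (1 - g₅) + g₁ * g₂ * g₅ * (1 - g₃) * (1 - g₄)
          + g₁ * g₃ * g₄ * (1 - g₂) * (1 - g₅) + g₁ * g₃ * g₅ * (1 - g₂) * (1 - g₄) + g₁ * g₄ * g₅ * (1 - g₂) * (1 - g₃)
          + g₂ * g₃ * g₄ * (1 - g₁) * (1 - g₅) + g₂ * g₃ * g₅ * (1 - g₁) * (1 - g₄) + g₂ * g₄ * g₅ * (1 - g₁) * (1 - g₃)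
          + g₃ * g₄ * g₅ * (1 - g₁) * (1 - g₂)))
    (v4 : ν (5 * lo + 4 * K) = a * (g₁ * g₂ * g₃ * g₄ * (1 - g₅) + g₁ * g₂ * g₃ * g₅ * (1 - g₄) + g₁ * g₂ * g₄ * g₅ * (1 - g₃) + g₁ * g₃ * g₄ * g₅ * (1 - g₂)
          + g₂ * g₃ * g₄ * g₅ * (1 - g₁))) :
    freeRate y T (5 * lo) (5 * lo + 4 * K) * ν (5 * lo) ≤ ν (5 * lo + 4 * K) ∧
      y * ((((5 * lo + 4 * K : ℕ) : ℝ)) - ((5 * lo : ℕ) : ℝ)) ≤ T - ((5 * lo : ℕ) : ℝ) ∧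
      freeRate y T (5 * lo + K) (5 * lo + 3 * K) * ν (5 * lo + K) ≤ ν (5 * lo + 3 * K) := by
  have hlo1 : 1 ≤ lo := by omega
  have hlo0 : (0 : ℝ) < lo := by exact_mod_cast (show 0 < lo by omega)
  have hK2R : 2 * (lo : ℝ) ≤ K := by exact_mod_cast hK2.le
  have hK4R : (K : ℝ) ≤ 4 * lo := by exact_mod_cast hK8
  have hK0 : (0 : ℝ) < K := by linarith
  have hg10 : 0 < g₁ := by
    by_contra hc; push Not at hc
    have : (K : ℝ) * g₁ ≤ 0 := mul_nonpos_of_nonneg_of_nonpos hK0.le hc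
    linarith
  have hg11 : g₁ < 1 := lt_of_le_of_lt h12 h21
  have hg₂K : (lo : ℝ) ≤ K * g₂ := le_trans hg (mul_le_mul_of_nonneg_left h12 hK0.le)
  have hg₃K : (lo : ℝ) ≤ K * g₃ := le_trans hg (mul_le_mul_of_nonneg_left h13 hK0.le)
  have hg₄K : (lo : ℝ) ≤ K * g₄ := le_trans hg (mul_le_mul_of_nonneg_left h14 hK0.le)
  have hg₅K : (lo : ℝ) ≤ K * g₅ := le_trans hg (mul_le_mul_of_nonneg_left h15 hK0.le)
  obtain ⟨hu0n, hu1n, hu2n, hu3n, hu4n⟩ := quintHub_masses_nonneg g₁ g₂ g₃ g₄ g₅ hg10.le (by linarith) (by linarith) (by linarith) (by linarith)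
    hg11.le h21.le h31.le h41.le h51.le
  set u0 : ℝ := ((1 - g₁) * (1 - g₂) * (1 - g₃) * (1 - g₄) * (1 - g₅)) with hu0
  set u1 : ℝ := (g₁ * (1 - g₂) * (1 - g₃) * (1 - g₄) * (1 - g₅) + g₂ * (1 - g₁) * (1 - g₃) * (1 - g₄) * (1 - g₅)
          + g₃ * (1 - g₁) * (1 - g₂) * (1 - g₄) * (1 - g₅) + g₄ * (1 - g₁) * (1 - g₂) * (1 - g₃) * (1 - g₅)
          + g₅ * (1 - g₁) * (1 - g₂) * (1 - g₃) * (1 - g₄)) with hu1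
  set u2 : ℝ := (g₁ * g₂ * (1 - g₃) * (1 - g₄) * (1 - g₅) + g₁ * g₃ * (1 - g₂) * (1 - g₄) * (1 - g₅) + g₁ * g₄ * (1 - g₂) * (1 - g₃) * (1 - g₅)
          + g₁ * g₅ * (1 - g₂) * (1 - g₃) * (1 - g₄) + g₂ * g₃ * (1 - g₁) * (1 - g₄) * (1 - g₅) + g₂ * g₄ * (1 - g₁) * (1 - g₃) * (1 - g₅)
          + g₂ * g₅ * (1 - g₁) * (1 - g₃) * (1 - g₄) + g₃ * g₄ * (1 - g₁) * (1 - g₂) * (1 - g₅) + g₃ * g₅ * (1 - g₁) * (1 - g₂) * (1 - g₄)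
          + g₄ * g₅ * (1 - g₁) * (1 - g₂) * (1 - g₃)) with hu2
  set u3 : ℝ := (g₁ * g₂ * g₃ * (1 - g₄) * (1 - g₅) + g₁ * g₂ * g₄ * (1 - g₃) * (1 - g₅) + g₁ * g₂ * g₅ * (1 - g₃) * (1 - g₄)
          + g₁ * g₃ * g₄ * (1 - g₂) * (1 - g₅) + g₁ * g₃ * g₅ * (1 - g₂) * (1 - g₄) + g₁ * g₄ * g₅ * (1 - g₂) * (1 - g₃)
          + g₂ * g₃ * g₄ * (1 - g₁) * (1 - g₅) + g₂ * g₃ * g₅ * (1 - g₁) * (1 - g₄) + g₂ * g₄ * g₅ * (1 - g₁) * (1 - g₃)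
          + g₃ * g₄ * g₅ * (1 - g₁) * (1 - g₂)) with hu3
  set u4 : ℝ := (g₁ * g₂ * g₃ * g₄ * (1 - g₅) + g₁ * g₂ * g₃ * g₅ * (1 - g₄) + g₁ * g₂ * g₄ * g₅ * (1 - g₃) + g₁ * g₃ * g₄ * g₅ * (1 - g₂)
          + g₂ * g₃ * g₄ * g₅ * (1 - g₁)) with hu4
  set T₀ : ℝ := 5 * (lo : ℝ) + K * (g₁ + g₂ + g₃ + g₄ + g₅) with hT₀
  have hT0p : 0 < T₀ := by
    have := mul_pos hK0 (by linarith : 0 < g₁ + g₂ + g₃ + g₄ + g₅); rw [hT₀]; linarith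
  have hTle : T ≤ T₀ := by
    have := mul_le_mul_of_nonneg_right ha1 hT0p.le; rw [hT]; linarith
  have hT0top : T₀ < 5 * (lo : ℝ) + 5 * K := by
    have := mul_lt_mul_of_pos_left (by linarith : g₁ + g₂ + g₃ + g₄ + g₅ < 5) hK0; rw [hT₀]; linarith
  have hx1 : x < 1 := by
    have : (lo : ℝ) + K * g₁ < lo + K := by have := mul_lt_mul_of_pos_left hg11 hK0; linarith
    by_contra hc; push Not at hc
    have : 1 * ((lo : ℝ) + K) ≤ x * (lo + K) := mul_le_mul_of_nonneg_right hc (by linarith)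
    linarith
  have hyx : y ≤ x := by rw [hy]; have := mul_le_mul_of_nonneg_right ha1 hx0.le; linarith
  have hy0 : 0 < y := by rw [hy]; exact mul_pos ha0 hx0
  have hy1 : y < 1 := lt_of_le_of_lt hyx hx1
  -- the crude floor bound `5y(lo+K) ≤ T`
  have hy5 : 5 * y * ((lo : ℝ) + K) ≤ T := by
    have h1 : 5 * (x * ((lo : ℝ) + K)) ≤ T₀ := by
      have : (K : ℝ) * (5 * g₁) ≤ K * (g₁ + g₂ + g₃ + g₄ + g₅) := mul_le_mul_of_nonneg_left (by linarith) hK0.le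
      rw [hT₀]; linarith
    have h2 := mul_le_mul_of_nonneg_left h1 ha0.le
    rw [hy, hT]; linarith
  clear_value u0 u1 u2 u3 u4 T₀
  set D : ℝ := T - 10 * (lo : ℝ) with hD
  have hD2 : 2 * (K : ℝ) < D := by rw [hD]; linarith
  have hDle : D ≤ K * (g₁ + g₂ + g₃ + g₄ + g₅) - 5 * lo := by have h := hTle; rw [hT₀] at h; rw [hD]; linarith
  have hD4 : D < 4 * K := by rw [hD]; linarith
  clear_value D
  have c5lo : ((5 * lo : ℕ) : ℝ) = 5 * (lo : ℝ) := by push_cast; ring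
  have cA1 : ((5 * lo + K : ℕ) : ℝ) = 5 * (lo : ℝ) + K := by push_cast; ring
  have hB0 : (0 : ℝ) < 5 * ((lo : ℝ) + K) := by linarith
  refine ⟨?_, ?_, ?_⟩
  · -- `5lo → 5lo+4K`, rate `max(y, D/(4K))`
    have ed : (((5 * lo + 4 * K : ℕ) : ℝ) - ((5 * lo : ℕ) : ℝ)) = 4 * K := by push_cast; ring
    have eD : T - 2 * (((5 * lo : ℕ) : ℝ)) = D := by rw [c5lo, hD]; ring
    have eθ : freeRate y T (5 * lo) (5 * lo + 4 * K) = max y (D / (4 * K)) / (1 - max y (D / (4 * K))) := by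
      unfold freeRate; rw [ed, eD]
    have hK40 : (0 : ℝ) < 4 * K := by linarith
    have hρ1 : D / (4 * K) < 1 := by rw [div_lt_one hK40]; linarith
    have hθlt : max y (D / (4 * K)) < 1 := max_lt hy1 hρ1
    rw [eθ]
    refine rate_mul_le_of_theta hθlt ?_ (g0 _)
    rw [v0, v4, show a * u0 + a * u4 = a * (u0 + u4) by ring, max_mul_of_nonneg _ _ (mul_nonneg ha0.le (add_nonneg hu0n hu4n))]
    refine max_le ?_ ?_
    · have hG := quintHub_capGK (lo : ℝ) K g₁ g₂ g₃ g₄ g₅ D hlo0 hK2R hK4R hg hg₂K hg₃K hg₄K hg₅K hg11.le h21.le h31.le h41.le h51.le hD2.le hDle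
      rw [← hu0, ← hu4] at hG
      have h1 : 5 * ((lo : ℝ) + K) * (y * (u0 + u4)) ≤ (D + 10 * lo) * (u0 + u4) := by
        have := mul_le_mul_of_nonneg_right hy5 (add_nonneg hu0n hu4n); rw [hD]; linarith
      have h3 := le_of_mul_le_mul_left (h1.trans hG) hB0
      have h4 : a * (y * (u0 + u4)) ≤ a * u4 := mul_le_mul_of_nonneg_left h3 ha0.le
      linarith
    · have hH := quintHub_capHK (lo : ℝ) K g₁ g₂ g₃ g₄ g₅ D hlo0 hK2R hK4R hg hg₂K hg₃K hg₄K hg₅K hg11.le h21.le h31.le h41.le h51.le hD2.le hDle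
      rw [← hu0, ← hu4] at hH
      rw [div_mul_eq_mul_div, div_le_iff₀ hK40]
      have h3 : a * (D * (u0 + u4)) ≤ a * (4 * K * u4) := mul_le_mul_of_nonneg_left (by linarith) ha0.le
      linarith
  · -- cost-safe: `4yK·5(lo+K) ≤ 4KT ≤ 5(lo+K)(T − 5lo)` since `T > 10lo + 2K`
    push_cast
    have h1 : 5 * ((lo : ℝ) + K) * (y * (4 * K)) ≤ 4 * K * T := by
      have := mul_le_mul_of_nonneg_right hy5 (show (0 : ℝ) ≤ 4 * K by linarith); linarith
    have hT2K : 10 * (lo : ℝ) + 2 * K ≤ T := hT102.le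
    have h2 : 4 * (K : ℝ) * T ≤ 5 * ((lo : ℝ) + K) * (T - 5 * lo) := by
      nlinarith [mul_nonneg (sub_nonneg.2 hK4R) hlo0.le, mul_nonneg (sub_nonneg.2 hT2K) hlo0.le,
        mul_nonneg (sub_nonneg.2 hT2K) hK0.le]
    have h3 : 5 * ((lo : ℝ) + K) * (y * (4 * K)) ≤ 5 * ((lo : ℝ) + K) * (T - 5 * lo) := le_trans h1 h2
    have h4 := le_of_mul_le_mul_left h3 hB0
    linarith
  · -- `5lo+K → 5lo+3K`, rate `max(y, (D−2K)/(2K))`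
    have ed : (((5 * lo + 3 * K : ℕ) : ℝ) - ((5 * lo + K : ℕ) : ℝ)) = 2 * K := by push_cast; ring
    have eD : T - 2 * (((5 * lo + K : ℕ) : ℝ)) = D - 2 * K := by rw [cA1, hD]; ring
    have eθ : freeRate y T (5 * lo + K) (5 * lo + 3 * K) = max y ((D - 2 * K) / (2 * K)) / (1 - max y ((D - 2 * K) / (2 * K))) := by
      unfold freeRate; rw [ed, eD]
    have hK20 : (0 : ℝ) < 2 * K := by linarith
    have hρ1 : (D - 2 * K) / (2 * K) < 1 := by rw [div_lt_one hK20]; linarith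
    have hθlt : max y ((D - 2 * K) / (2 * K)) < 1 := max_lt hy1 hρ1
    rw [eθ]
    refine rate_mul_le_of_theta hθlt ?_ (g0 _)
    rw [v1, v3, show a * u1 + a * u3 = a * (u1 + u3) by ring, max_mul_of_nonneg _ _ (mul_nonneg ha0.le (add_nonneg hu1n hu3n))]
    refine max_le ?_ ?_
    · have hE := quintHub_capEK (lo : ℝ) K g₁ g₂ g₃ g₄ g₅ D hlo0 hK2R hK4R hg hg₂K hg₃K hg₄K hg₅K hg11.le h21.le h31.le h41.le h51.le hD2.le hDle
      rw [← hu1, ← hu3] at hE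
      have h1 : 5 * ((lo : ℝ) + K) * (y * (u1 + u3)) ≤ (D + 10 * lo) * (u1 + u3) := by
        have := mul_le_mul_of_nonneg_right hy5 (add_nonneg hu1n hu3n); rw [hD]; linarith
      have h3 := le_of_mul_le_mul_left (h1.trans hE) hB0
      have h4 : a * (y * (u1 + u3)) ≤ a * u3 := mul_le_mul_of_nonneg_left h3 ha0.le
      linarith
    · have hF := quintHub_capFK (lo : ℝ) K g₁ g₂ g₃ g₄ g₅ D hlo0 hK2R hK4R hg hg₂K hg₃K hg₄K hg₅K hg11.le h21.le h31.le h41.le h51.le hD2.le hDle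
      rw [← hu1, ← hu3] at hF
      rw [div_mul_eq_mul_div, div_le_iff₀ hK20]
      have h3 : a * ((D - 2 * K) * (u1 + u3)) ≤ a * (2 * K * u3) := mul_le_mul_of_nonneg_left (by linarith) ha0.le
      linarith

end LawDec
end Quant
end Summit.CriticalPhenomena.PercolationContinuityZ3.Theorems
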